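import Mathlib
import Summits.Ventures.PercRepro2.Defs
import Summits.Ventures.PercRepro2.Graph

/-!
# Connections through a degree-two vertex (blind cell PercRepro2, p2 g35; proofs/P2-G35-PENDZ.md §7, §9)

The two tight families of the pendant-root candidate `(Z″)` — the mark `b` (resp. `o`) adjacent
ONLY to the root `a₂` and the attachment vertex `v` — are handled on paper by «peeling» the two
edges of the degree-two vertex: with both edges open, a vertex `o ≠ b` is connected to `a₂` iff, in the
configuration with the two edges closed, it is connected to `a₂` or to `v`
(`conn_iff_of_two_edges`); with both edges closed `b` is isolated (`not_conn_of_two_edges_closed`).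
These are the graph lemmas of that reduction (the mass identities per pin state follow from them
and `prob_eq_pin`; not in this file).  Std axioms.
-/

namespace Summit.Ventures.PercRepro2

namespace RowC1

section TwoEdge

variable {V : Type*} {E : Type*}

/-- Closing edges lowers the configuration. -/
lemma update_false_le (ω : Config E) (e : E) [DecidableEq E] : Function.update ω e false ≤ ω := by
  intro f
  by_cases h : f = e
  · subst h; simp
  · simp [Function.update_of_ne h]

/-- **Through a degree-two vertex**: if `b`'s only edges are `e₁ = a₂b` and `e₂ = vb` and both are
open, then for `o ≠ b`: `a₂ ↔ o` iff, with both edges closed, `a₂ ↔ o` or `v ↔ o`. -/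
theorem conn_iff_of_two_edges [DecidableEq E] (ends : E → Sym2 V) (e₁ e₂ : E) (a₂ v b o : V)
    (h1 : ends e₁ = s(a₂, b)) (h2 : ends e₂ = s(v, b)) (hdeg : ∀ e, b ∈ ends e → e = e₁ ∨ e = e₂)
    (hbo : b ≠ o) (ω : Config E) (ho1 : ω e₁ = true) (ho2 : ω e₂ = true) :
    Conn ends ω a₂ o ↔
      Conn ends (Function.update (Function.update ω e₁ false) e₂ false) a₂ o ∨
        Conn ends (Function.update (Function.update ω e₁ false) e₂ false) v o := by
  set ω₀ := Function.update (Function.update ω e₁ false) e₂ false with hω₀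
  have hle : ω₀ ≤ ω := (update_false_le _ e₂).trans (update_false_le ω e₁)
  have hadj₁ : OpenAdj ends ω a₂ b := ⟨e₁, ho1, h1⟩
  have hadj₂ : OpenAdj ends ω b v := ⟨e₂, ho2, by rw [h2, Sym2.eq_swap]⟩
  constructor
  · intro h
    -- closure argument: `S` = vertices reached from `a₂` or `v` off the two edges, plus `b`
    let S : Set V := {x | Conn ends ω₀ a₂ x ∨ Conn ends ω₀ v x ∨ x = b}
    have hS : ∀ x ∈ S, ∀ y, (openGraph ends ω).Adj x y → y ∈ S := by
      intro x hx y hxy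
      rw [openGraph_adj] at hxy
      obtain ⟨hne, e, he, hends⟩ := hxy
      by_cases he1 : e = e₁
      · subst he1
        rw [h1] at hends
        rcases Sym2.eq_iff.1 hends.symm with ⟨_, rfl⟩ | ⟨_, rfl⟩
        · exact Or.inr (Or.inr rfl)
        · exact Or.inl (conn_refl _ _ _)
      by_cases he2 : e = e₂
      · subst he2
        rw [h2] at hends
        rcases Sym2.eq_iff.1 hends.symm with ⟨_, rfl⟩ | ⟨_, rfl⟩
        · exact Or.inr (Or.inr rfl)
        · exact Or.inr (Or.inl (conn_refl _ _ _))
      -- `e` is off the two edges: it is open in `ω₀` as well, and `x ≠ b`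
      have he0 : ω₀ e = true := by
        simp only [hω₀, Function.update_of_ne he2, Function.update_of_ne he1, he]
      have hxb : x ≠ b := by
        rintro rfl
        have hmem : x ∈ ends e := by rw [hends]; exact Sym2.mem_mk_left _ _
        rcases hdeg e hmem with h | h
        · exact he1 h
        · exact he2 h
      have hxy0 : Conn ends ω₀ x y := conn_of_openAdj ⟨e, he0, hends⟩
      rcases hx with hx | hx | hx
      · exact Or.inl (conn_trans hx hxy0)
      · exact Or.inr (Or.inl (conn_trans hx hxy0))
      · exact absurd hx hxb
    have ha : a₂ ∈ S := Or.inl (conn_refl _ _ _)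
    have ho : o ∈ S := mem_of_conn_of_closed hS ha h
    rcases ho with ho | ho | ho
    · exact Or.inl ho
    · exact Or.inr ho
    · exact absurd ho.symm hbo
  · rintro (h | h)
    · exact conn_mono hle h
    · exact conn_trans (conn_trans (conn_of_openAdj hadj₁) (conn_of_openAdj hadj₂))
        (conn_mono hle h)

/-- With both of its edges closed a degree-two vertex is isolated: no `o ≠ b` is connected to it. -/
theorem not_conn_of_two_edges_closed (ends : E → Sym2 V) (e₁ e₂ : E) (b o : V)
    (hdeg : ∀ e, b ∈ ends e → e = e₁ ∨ e = e₂) (hbo : b ≠ o) (ω : Config E)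
    (hc1 : ω e₁ = false) (hc2 : ω e₂ = false) : ¬ Conn ends ω b o := by
  intro h
  let S : Set V := {x | x = b}
  have hS : ∀ x ∈ S, ∀ y, (openGraph ends ω).Adj x y → y ∈ S := by
    intro x hx y hxy
    rw [openGraph_adj] at hxy
    obtain ⟨_, e, he, hends⟩ := hxy
    have hx' : x = b := hx
    subst hx'
    have hmem : x ∈ ends e := by rw [hends]; exact Sym2.mem_mk_left _ _
    rcases hdeg e hmem with rfl | rfl
    · rw [hc1] at he; exact absurd he Bool.false_ne_true
    · rw [hc2] at he; exact absurd he Bool.false_ne_true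
  have := mem_of_conn_of_closed hS (show b ∈ S from rfl) h
  exact hbo (this : o = b).symm

end TwoEdge

end RowC1

end Summit.Ventures.PercRepro2

/-! ## Dead ends (p2 g35): with one of the two edges closed, the other is invisible to connections
between vertices other than `b`. -/

namespace Summit.Ventures.PercRepro2

namespace RowC1

section TwoEdgeDeadEnd

variable {V : Type*} {E : Type*}

/-- **Dead end**: if `b`'s only edges are `f = ab` and `g = cb` (`f ≠ g`) and `g` is closed, then
connections between vertices other than `b` do not see `f`. -/
theorem conn_iff_deadend [DecidableEq E] (ends : E → Sym2 V) (f g : E) (a c b x y : V)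
    (hf : ends f = s(a, b)) (hg : ends g = s(c, b)) (hdeg : ∀ e, b ∈ ends e → e = f ∨ e = g)
    (hfg : f ≠ g) (hxb : x ≠ b) (hyb : y ≠ b) (ω : Config E) (hgc : ω g = false) :
    Conn ends ω x y ↔ Conn ends (Function.update ω f false) x y := by
  set ω' := Function.update ω f false with hω'
  have hle : ω' ≤ ω := by
    intro e
    by_cases h : e = f
    · subst h; simp [hω']
    · simp [hω', Function.update_of_ne h]
  have hiso : ¬ Conn ends ω' b x := by
    refine not_conn_of_two_edges_closed ends f g b x hdeg hxb.symm ω' ?_ ?_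
    · simp [hω']
    · simp [hω', Function.update_of_ne hfg.symm, hgc]
  constructor
  · intro h
    let S : Set V := {z | Conn ends ω' x z ∨ (z = b ∧ Conn ends ω' x a)}
    have hS : ∀ z ∈ S, ∀ w, (openGraph ends ω).Adj z w → w ∈ S := by
      intro z hz w hzw
      rw [openGraph_adj] at hzw
      obtain ⟨hne, e, he, hends⟩ := hzw
      by_cases hef : e = f
      · subst hef
        rw [hf] at hends
        rcases Sym2.eq_iff.1 hends.symm with ⟨hza, hwb⟩ | ⟨hzb, hwa⟩
        · -- `z = a`, `w = b`
          rcases hz with hz | ⟨hz, _⟩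
          · exact Or.inr ⟨hwb, hza ▸ hz⟩
          · exact absurd hz (hne.trans_eq hwb)
        · -- `z = b`, `w = a`
          rcases hz with hz | ⟨_, hz⟩
          · exact absurd (conn_symm (hzb ▸ hz)) hiso
          · exact Or.inl (hwa ▸ hz)
      by_cases heg : e = g
      · subst heg
        rw [hgc] at he
        exact absurd he Bool.false_ne_true
      have he' : ω' e = true := by simp [hω', Function.update_of_ne hef, he]
      have hzb : z ≠ b := by
        rintro rfl
        have hmem : z ∈ ends e := by rw [hends]; exact Sym2.mem_mk_left _ _
        rcases hdeg e hmem with h | h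
        · exact hef h
        · exact heg h
      have hzw' : Conn ends ω' z w := conn_of_openAdj ⟨e, he', hends⟩
      rcases hz with hz | ⟨hz, _⟩
      · exact Or.inl (conn_trans hz hzw')
      · exact absurd hz hzb
    have hx : x ∈ S := Or.inl (conn_refl _ _ _)
    have hy : y ∈ S := mem_of_conn_of_closed hS hx h
    rcases hy with hy | ⟨hy, _⟩
    · exact hy
    · exact absurd hy hyb
  · intro h
    exact conn_mono hle h

end TwoEdgeDeadEnd

end RowC1

end Summit.Ventures.PercRepro2
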